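import Literature.MathematicalPhysics.QuantumManyBody.PeriodicKineticBudget
import Literature.MathematicalPhysics.QuantumManyBody.PeriodicBoseGasUpperBoundProofs
import Literature.MathematicalPhysics.QuantumManyBody.PeriodicBoseGasThm31
import Literature.MathematicalPhysics.QuantumManyBody.PeriodicBoseGasFourier
import Mathlib.Analysis.Calculus.ContDiff.Basic
import HarnessLib

/-!
# Route `BECPhaseQuadratureSumRule`, glue `SumRuleChainGlue` (stmt-AtomisticToContinuum-12627) —
# helper: the coupling path `t ↦ t·v`, uniform energy budget, the constant state, and the free case `a = 0`

Inputs of the chain that concern energies only: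

* `smoothClass_smul` — the smooth class (finite, `C²` as `ṽ(x) = v(|x|)`, finite range, edge condition
  `‖D²ṽ‖ ≤ Cₑ√ṽ`) is closed under `v ↦ t·v`, `0 ≤ t`, with edge constant `√t·Cₑ`; `smul_one_eq` (`1·v = v`);
* `periodicEnergy_le_of_minimiser_uniform` — **uniform energy budget**: for `R > 0` there is `ρ₁ > 0` such that
  for `0 < ρ < ρ₁` and all large `N`, every minimiser of ANY potential vanishing beyond `R` on the torus of side
  `(N/ρ)^{1/3}` has `periodicEnergy ≤ 16πRρN` (so kinetic AND potential energy are `O(ρN)` uniformly in `t`), from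
  `E₀^per(v) ≤ E₀^per(hard core 2R) ≤ 4πρ₁a(1 + Ca/b)N` [LSSY2005, Thm. 2.2 (2.14)], proved in the tree;
* `exists_constState` — the constant state `L^{-3N/2}` is a periodic trial state with zero free energy and
  `n₀ = N`; `periodicGroundStateEnergy_zero`;
* `pot_eq_zero_of_scatteringLength_eq_zero` — if `a(v) = 0` for a continuous finite-range
  profile then `v(|x|) ≡ 0` [LSSY2005, App. C], so every periodic energy is the free one.
-/

noncomputable section

open MeasureTheory Filter Set
open scoped ENNReal NNReal Topology

namespace Summit.AtomisticToContinuum.BoseEinsteinCondensation.Theorems.SumRuleChainGlue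

open Literature.MathematicalPhysics.QuantumManyBody.BoseGas

/-! ### The coupling path stays in the smooth class -/

/-- `(t·v)(|x|) = t · v(|x|)` as real numbers, `0 ≤ t`. -/
theorem toReal_smul_pot (v : ℝ → ℝ≥0∞) {t : ℝ} (ht : 0 ≤ t) (x : Space) :
    ((fun r => ENNReal.ofReal t * v r) ‖x‖).toReal = t * (v ‖x‖).toReal := by
  simp only [ENNReal.toReal_mul, ENNReal.toReal_ofReal ht]

/-- **The smooth class is closed under `v ↦ t·v` (`0 ≤ t`)**, with edge constant `√t · Cₑ`. -/
theorem smoothClass_smul {v : ℝ → ℝ≥0∞} (hv : IsRepulsiveFiniteRange v) (hfin : ∀ r, v r ≠ ⊤)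
    (hC2 : ContDiff ℝ 2 fun x : Space => (v ‖x‖).toReal)
    (hedge : ∃ Cₑ : ℝ, ∀ x : Space, ‖iteratedFDeriv ℝ 2 (fun x : Space => (v ‖x‖).toReal) x‖ ≤
      Cₑ * Real.sqrt ((v ‖x‖).toReal)) {t : ℝ} (ht : 0 ≤ t) :
    IsRepulsiveFiniteRange (fun r => ENNReal.ofReal t * v r) ∧ (∀ r, ENNReal.ofReal t * v r ≠ ⊤) ∧
      ContDiff ℝ 2 (fun x : Space => ((fun r => ENNReal.ofReal t * v r) ‖x‖).toReal) ∧
      ∃ Cₑ : ℝ, ∀ x : Space, ‖iteratedFDeriv ℝ 2 (fun x : Space => ((fun r => ENNReal.ofReal t * v r) ‖x‖).toReal) x‖ ≤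
        Cₑ * Real.sqrt (((fun r => ENNReal.ofReal t * v r) ‖x‖).toReal) := by
  obtain ⟨hmeas, R₀, hR₀⟩ := hv
  obtain ⟨Cₑ, hCₑ⟩ := hedge
  have hfun : (fun x : Space => ((fun r => ENNReal.ofReal t * v r) ‖x‖).toReal) =
      fun x : Space => t • (v ‖x‖).toReal := by
    funext x; rw [toReal_smul_pot v ht, smul_eq_mul]
  refine ⟨⟨measurable_const.mul hmeas, R₀, fun r hr => show ENNReal.ofReal t * v r = 0 by rw [hR₀ r hr, mul_zero]⟩,
    fun r => ENNReal.mul_ne_top ENNReal.ofReal_ne_top (hfin r), ?_, ?_⟩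
  · rw [hfun]; exact hC2.const_smul t
  · refine ⟨Real.sqrt t * Cₑ, fun x => ?_⟩
    rw [hfun, iteratedFDeriv_const_smul_apply' (hC2.contDiffAt), norm_smul, Real.norm_of_nonneg ht,
      toReal_smul_pot v ht, Real.sqrt_mul ht]
    calc t * ‖iteratedFDeriv ℝ 2 (fun x : Space => (v ‖x‖).toReal) x‖
        ≤ t * (Cₑ * Real.sqrt ((v ‖x‖).toReal)) := mul_le_mul_of_nonneg_left (hCₑ x) ht
      _ = Real.sqrt t * Cₑ * (Real.sqrt t * Real.sqrt ((v ‖x‖).toReal)) := by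
          have := Real.mul_self_sqrt ht
          ring_nf
          rw [Real.sq_sqrt ht]
          ring

/-- `1 · v = v`. -/
theorem smul_one_eq (v : ℝ → ℝ≥0∞) : (fun r => ENNReal.ofReal 1 * v r) = v := by
  funext r; rw [ENNReal.ofReal_one, one_mul]

/-- `t · v ≤ v` for `t ≤ 1`. -/
theorem smul_le_self (v : ℝ → ℝ≥0∞) {t : ℝ} (ht : t ≤ 1) (r : ℝ) : ENNReal.ofReal t * v r ≤ v r := by
  calc ENNReal.ofReal t * v r ≤ 1 * v r := by
        gcongr; rw [← ENNReal.ofReal_one]; exact ENNReal.ofReal_le_ofReal ht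
    _ = v r := one_mul _

/-- `t · v` vanishes where `v` does. -/
theorem smul_eq_zero_of_range {v : ℝ → ℝ≥0∞} {R₀ : ℝ} (hR₀ : ∀ r, R₀ < r → v r = 0) (t : ℝ) (r : ℝ)
    (hr : R₀ < r) : ENNReal.ofReal t * v r = 0 := by
  rw [hR₀ r hr, mul_zero]

/-! ### Uniform energy budget of minimisers -/

/-- **Uniform energy budget.** For every `R > 0` there is `ρ₁ > 0` such that for `0 < ρ < ρ₁` and all large
`N`, every minimiser of the periodic energy of ANY potential vanishing beyond `R` on the torus of side
`(N/ρ)^{1/3}` has `periodicEnergy ≤ 16πRρN` (`E₀^per(v) ≤ E₀^per(hard core 2R) ≤ 4πρ₁a(1+Ca/b)N`, `a = 2R`;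
the tree's `kinetic_le_of_minimiser_uniform` with the full energy kept). -/
theorem periodicEnergy_le_of_minimiser_uniform {R : ℝ} (hR : 0 < R) :
    ∃ ρ₁ : ℝ, 0 < ρ₁ ∧ ∀ ρ : ℝ, 0 < ρ → ρ < ρ₁ → ∀ᶠ N : ℕ in atTop,
      ∀ v : ℝ → ℝ≥0∞, (∀ r, R < r → v r = 0) →
      ∀ Ψ : PeriodicTrialState N (sideLength ρ N),
        periodicEnergy v Ψ = periodicGroundStateEnergy v N (sideLength ρ N) →
        periodicEnergy v Ψ ≤ ENNReal.ofReal (16 * Real.pi * R * ρ * N) := by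
  set w : ℝ → ℝ≥0∞ := hardCorePotential (2 * R) with hw
  have hwr : ∀ r, 2 * R < r → w r = 0 := fun r hr => hardCorePotential_of_le hr.le
  have haw : scatteringLength w = ENNReal.ofReal (2 * R) := scatteringLength_hardCorePotential _
  obtain ⟨C, c, hC, hc, H⟩ := LSSY2005_upperBound_periodic_holds w (2 * R)
    (measurable_hardCorePotential _) hwr (by rw [haw]; exact ENNReal.ofReal_ne_top)
  have ha : (scatteringLength w).toReal = 2 * R := by
    rw [haw, ENNReal.toReal_ofReal (by linarith)]
  set c' : ℝ := min c (1 / C) with hc'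
  have hc'pos : 0 < c' := lt_min hc (by positivity)
  set ρ₁ : ℝ := 3 * (c' / (2 * R)) ^ 3 / (4 * Real.pi) with hρ₁
  have hρ₁pos : 0 < ρ₁ := by positivity
  refine ⟨ρ₁, hρ₁pos, fun ρ hρ hρlt => ?_⟩
  filter_upwards [eventually_ge_atTop 2, (tendsto_sideLength_atTop hρ).eventually_gt_atTop (2 * (2 * R))]
    with N hN2 hLR v hvR
  have hN0 : 0 < N := by omega
  have hL : 0 < sideLength ρ N := by
    unfold sideLength; exact Real.rpow_pos_of_pos (div_pos (by exact_mod_cast hN0) hρ) _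
  have hρL : (N : ℝ) / sideLength ρ N ^ 3 = ρ := div_sideLength_pow_three hρ hN0
  generalize sideLength ρ N = L at hL hρL hLR ⊢
  intro Ψ hmin
  set ρe : ℝ := ((N : ℝ) - 1) / L ^ 3 with hρe
  have hρe_le : ρe ≤ ρ := by
    rw [hρe, ← hρL]
    exact div_le_div_of_nonneg_right (by linarith) (by positivity)
  have hρe_pos : 0 < ρe := by
    rw [hρe]
    have : (2 : ℝ) ≤ N := by exact_mod_cast hN2
    exact div_pos (by linarith) (by positivity)
  have hx_pos : 0 < 4 * Real.pi * ρe / 3 := by positivity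
  have hab_eq : (2 * R) / (4 * Real.pi * ρe / 3) ^ (-(1 : ℝ) / 3) =
      2 * R * (4 * Real.pi * ρe / 3) ^ ((1 : ℝ) / 3) := by
    rw [show (-(1 : ℝ) / 3) = -(1 / 3) by norm_num, Real.rpow_neg hx_pos.le, div_inv_eq_mul]
  have hab_lt : 2 * R * (4 * Real.pi * ρe / 3) ^ ((1 : ℝ) / 3) < c' := by
    have h1 : (4 * Real.pi * ρe / 3) ^ ((1 : ℝ) / 3) ≤ (4 * Real.pi * ρ / 3) ^ ((1 : ℝ) / 3) :=
      Real.rpow_le_rpow hx_pos.le (by gcongr) (by norm_num)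
    have h2 : (4 * Real.pi * ρ / 3) ^ ((1 : ℝ) / 3) < (4 * Real.pi * ρ₁ / 3) ^ ((1 : ℝ) / 3) :=
      Real.rpow_lt_rpow (by positivity) (by gcongr) (by norm_num)
    have h3 : (4 * Real.pi * ρ₁ / 3) ^ ((1 : ℝ) / 3) = c' / (2 * R) := by
      rw [hρ₁]
      have : 4 * Real.pi * (3 * (c' / (2 * R)) ^ 3 / (4 * Real.pi)) / 3 = (c' / (2 * R)) ^ 3 := by
        field_simp
      rw [this, show ((1 : ℝ) / 3) = ((3 : ℕ) : ℝ)⁻¹ by norm_num,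
        Real.pow_rpow_inv_natCast (by positivity) three_ne_zero]
    calc 2 * R * (4 * Real.pi * ρe / 3) ^ ((1 : ℝ) / 3)
        < 2 * R * (c' / (2 * R)) := by
          apply mul_lt_mul_of_pos_left (h1.trans_lt (h2.trans_eq h3)) (by linarith)
      _ = c' := by field_simp
  have hab_c : (2 * R) / (4 * Real.pi * ρe / 3) ^ (-(1 : ℝ) / 3) ≤ c := by
    rw [hab_eq]; exact (hab_lt.le.trans (min_le_left _ _))
  have hab_C : C * ((2 * R) / (4 * Real.pi * ρe / 3) ^ (-(1 : ℝ) / 3)) ≤ 1 := by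
    rw [hab_eq]
    have h1 : 2 * R * (4 * Real.pi * ρe / 3) ^ ((1 : ℝ) / 3) ≤ 1 / C :=
      hab_lt.le.trans (min_le_right _ _)
    calc C * (2 * R * (4 * Real.pi * ρe / 3) ^ ((1 : ℝ) / 3)) ≤ C * (1 / C) :=
          mul_le_mul_of_nonneg_left h1 hC.le
      _ = 1 := by field_simp
  have hU := H N L hN2 hL (by linarith)
  simp only at hU
  rw [ha] at hU
  have hU' := hU hab_c
  calc periodicEnergy v Ψ = periodicGroundStateEnergy v N L := hmin
    _ ≤ periodicGroundStateEnergy w N L :=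
        periodicGroundStateEnergy_mono_of_le (le_hardCorePotential_two_mul hR hvR)
    _ ≤ ENNReal.ofReal (4 * Real.pi * ρe * (2 * R) *
          (1 + C * ((2 * R) / (4 * Real.pi * ρe / 3) ^ (-(1 : ℝ) / 3))) * N) := hU'
    _ ≤ ENNReal.ofReal (16 * Real.pi * R * ρ * N) := by
        apply ENNReal.ofReal_le_ofReal
        have hN' : (0 : ℝ) ≤ N := N.cast_nonneg
        have h1 : 1 + C * ((2 * R) / (4 * Real.pi * ρe / 3) ^ (-(1 : ℝ) / 3)) ≤ 2 := by linarith
        have h0 : 0 ≤ 1 + C * ((2 * R) / (4 * Real.pi * ρe / 3) ^ (-(1 : ℝ) / 3)) := by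
          rw [hab_eq]; positivity
        calc 4 * Real.pi * ρe * (2 * R) * (1 + C * ((2 * R) / (4 * Real.pi * ρe / 3) ^ (-(1 : ℝ) / 3))) * N
            ≤ 4 * Real.pi * ρ * (2 * R) * 2 * N := by gcongr
          _ = 16 * Real.pi * R * ρ * N := by ring

/-- The potential energy of a trial state is at most its energy. -/
theorem lintegral_periodicInteraction_le_periodicEnergy {N : ℕ} {L : ℝ} (v : ℝ → ℝ≥0∞)
    (Ψ : PeriodicTrialState N L) :
    ∫⁻ X in cellN N L, periodicInteraction v L X * (‖Ψ.ψ X‖₊ : ℝ≥0∞) ^ 2 ≤ periodicEnergy v Ψ :=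
  lintegral_mono fun _ => le_add_self

/-! ### The constant state -/

/-- `‖L^{-3N/2}‖₊² = (L^{3N})⁻¹` in `ℝ≥0∞`. -/
theorem nnnorm_const_sq {L : ℝ} (hL : 0 < L) (N : ℕ) :
    ((‖((Real.sqrt ((L ^ 3) ^ N))⁻¹ : ℂ)‖₊ : ℝ≥0∞) ^ 2) = ((ENNReal.ofReal L ^ 3) ^ N)⁻¹ := by
  have hLN : 0 < (L ^ 3) ^ N := by positivity
  rw [coe_nnnorm_sq_eq_ofReal, norm_inv, Complex.norm_real, Real.norm_of_nonneg (Real.sqrt_nonneg _), inv_pow,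
    Real.sq_sqrt hLN.le, ENNReal.ofReal_inv_of_pos hLN, ENNReal.ofReal_pow (by positivity), ENNReal.ofReal_pow hL.le]

/-- **The constant state.** On the torus of side `L > 0` the constant `N`-particle state `Ψ ≡ L^{-3N/2}` is an
admissible periodic trial state with zero free energy and full condensation `n₀ = N`. -/
theorem exists_constState {L : ℝ} (hL : 0 < L) (N : ℕ) :
    ∃ Ψ : PeriodicTrialState N L, periodicEnergy 0 Ψ = 0 ∧ condensateOccupation N L Ψ.ψ = N := by
  have h0 : (ENNReal.ofReal L ^ 3) ^ N ≠ 0 := pow_ne_zero _ (pow_ne_zero _ (by simpa using hL))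
  have htop : (ENNReal.ofReal L ^ 3) ^ N ≠ ⊤ := ENNReal.pow_ne_top (ENNReal.pow_ne_top ENNReal.ofReal_ne_top)
  set c : ℂ := ((Real.sqrt ((L ^ 3) ^ N))⁻¹ : ℂ) with hc
  let Ψ : PeriodicTrialState N L := ⟨fun _ => c, contDiff_const, fun _ _ _ => rfl, fun _ _ => rfl, by
    rw [setLIntegral_const, volume_cellN, hc, nnnorm_const_sq hL N, ENNReal.inv_mul_cancel h0 htop]⟩
  refine ⟨Ψ, ?_, ?_⟩
  · refine (lintegral_congr fun X => ?_).trans lintegral_zero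
    simp [Ψ, kineticDensity, periodicInteraction, periodizedPotential]
  · cases N with
    | zero => simp [condensateOccupation, occupation]
    | succ n =>
      have hL3r : 0 < L ^ 3 := by positivity
      rw [condensateOccupation_succ hL]
      simp only [Ψ]
      rw [setIntegral_const, setLIntegral_const, volume_cellN, measureReal_def, volume_cell,
        ENNReal.toReal_pow, ENNReal.toReal_ofReal hL.le, Complex.real_smul, hc]
      have hX : ((‖((L ^ 3 : ℝ) : ℂ) * ((Real.sqrt ((L ^ 3) ^ (n + 1)))⁻¹ : ℂ)‖₊ : ℝ≥0∞) ^ 2) =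
          ENNReal.ofReal ((L ^ 3) ^ 2 * ((L ^ 3) ^ (n + 1))⁻¹) := by
        rw [coe_nnnorm_sq_eq_ofReal, norm_mul, Complex.norm_real, Real.norm_of_nonneg hL3r.le, norm_inv, Complex.norm_real,
          Real.norm_of_nonneg (Real.sqrt_nonneg _), mul_pow, inv_pow, Real.sq_sqrt (by positivity)]
      have hinv : (ENNReal.ofReal L ^ 3)⁻¹ = ENNReal.ofReal ((L ^ 3)⁻¹) := by
        rw [← ENNReal.ofReal_pow hL.le, ENNReal.ofReal_inv_of_pos hL3r]
      have hpow : (ENNReal.ofReal L ^ 3) ^ n = ENNReal.ofReal ((L ^ 3) ^ n) := by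
        rw [← ENNReal.ofReal_pow hL.le, ENNReal.ofReal_pow hL3r.le]
      rw [hX, hinv, hpow, ← ENNReal.ofReal_mul (by positivity), ← ENNReal.ofReal_mul (by positivity)]
      have h1 : (L ^ 3)⁻¹ * ((L ^ 3) ^ 2 * ((L ^ 3) ^ (n + 1))⁻¹ * (L ^ 3) ^ n) = 1 := by
        field_simp
        ring
      rw [h1, ENNReal.ofReal_one, mul_one]
      push_cast
      ring

/-- The free periodic ground-state energy vanishes (`L > 0`). -/
theorem periodicGroundStateEnergy_zero {L : ℝ} (hL : 0 < L) (N : ℕ) : periodicGroundStateEnergy 0 N L = 0 := by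
  obtain ⟨Ψ, hΨ, -⟩ := exists_constState hL N
  exact le_antisymm ((periodicGroundStateEnergy_le 0 Ψ).trans hΨ.le) bot_le

/-! ### The free case `a = 0` -/

/-- **Zero scattering length kills the interaction** [LSSY2005, App. C]: for a finite profile of finite range,
continuous as `x ↦ v(|x|)`, `a(v) = 0` forces `v(|x|) = 0` for every `x ∈ ℝ³` (a.e. by the tree's
`LSSY2005_zeroScatteringLength_holds`, everywhere by continuity). -/
theorem pot_eq_zero_of_scatteringLength_eq_zero {v : ℝ → ℝ≥0∞} (hv : IsRepulsiveFiniteRange v) (hfin : ∀ r, v r ≠ ⊤)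
    (hcont : Continuous fun x : Space => (v ‖x‖).toReal) (ha : scatteringLength v = 0) (x : Space) : v ‖x‖ = 0 := by
  obtain ⟨hmeas, R₀, hR₀⟩ := hv
  have hae := LSSY2005_zeroScatteringLength_holds v R₀ hmeas hR₀ ha
  have hae' : (fun x : Space => (v ‖x‖).toReal) =ᵐ[volume] fun _ => (0 : ℝ) :=
    hae.mono fun y hy => by simp [hy]
  have heq := (Continuous.ae_eq_iff_eq volume hcont continuous_const).1 hae'
  have hx : (v ‖x‖).toReal = 0 := congrFun heq x
  rw [← ENNReal.ofReal_toReal (hfin ‖x‖), hx, ENNReal.ofReal_zero]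

/-- In the free case every periodic interaction vanishes. -/
theorem periodicInteraction_eq_zero_of_pot_eq_zero {v : ℝ → ℝ≥0∞} (h0 : ∀ x : Space, v ‖x‖ = 0) {N : ℕ}
    (L : ℝ) (X : Config N) : periodicInteraction v L X = 0 := by
  refine Finset.sum_eq_zero fun i _ => Finset.sum_eq_zero fun j _ => ?_
  unfold periodizedPotential
  simp only [h0, tsum_zero]

/-- In the free case every periodic energy is the free one. -/
theorem periodicEnergy_eq_zero_pot {v : ℝ → ℝ≥0∞} (h0 : ∀ x : Space, v ‖x‖ = 0) {N : ℕ} {L : ℝ}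
    (Ψ : PeriodicTrialState N L) : periodicEnergy v Ψ = periodicEnergy 0 Ψ := by
  refine lintegral_congr fun X => ?_
  rw [periodicInteraction_eq_zero_of_pot_eq_zero h0, periodicInteraction_eq_zero_of_pot_eq_zero (fun _ => rfl)]

end Summit.AtomisticToContinuum.BoseEinsteinCondensation.Theorems.SumRuleChainGlue

end
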